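import Summits.KontsevichZagierPeriods.KontsevichZagierPeriods.Theorems.UnfoldedStokesStokesGenerationFibrewiseRungSeparated
import Summits.KontsevichZagierPeriods.KontsevichZagierPeriods.Theorems.UnfoldedStokesStokesGenerationStubBoxToCube

/-!
# `StokesGeneration` (stmt-KontsevichZagierPeriods-3586), line `fibrewise_stokes` — rung 9f: THEOREM D on boxes with algebraic corners (kernel form)

Crux `Summit.KontsevichZagierPeriods.KontsevichZagierPeriods.Theses.UnfoldedStokes.StokesGeneration` (the kernel conjecture of the
Kontsevich–Zagier calculus). THEOREM D of the line (`of_mem_relations_separatedRat`, p132794) says that a closed-UNIT-CUBE representation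
with a separated-variables `K`-rational integrand of value `0` is a Kontsevich–Zagier relation. This file states the corollary in KZ's
native language for closed BOXES `Π [lᵢ, uᵢ]` with real algebraic corners (`of_mem_relations_separatedRat_box`): one affine change of
variables with constant Jacobian (`stub_boxToCube`, p133816 — the only move used outside S2's economy) cubifies the representation, the
cubified integrand is again separated `K`-rational (the polynomials composed with the affine map), and THEOREM D applies.

References: M. Kontsevich, D. Zagier, *Periods* (2001), §1.2 rule (2) and Conjecture 1.
-/

noncomputable section

set_option linter.dupNamespace false

namespace Summit.KontsevichZagierPeriods.KontsevichZagierPeriods.Cruxes.StokesGeneration.FibrewiseStokes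

open MeasureTheory Set
open Literature.NumberTheory.Transcendental
open Literature.NumberTheory.Transcendental.KZ
open Literature.ModelTheory.ExponentialFields (IsSemialgebraic)
open scoped Polynomial

/-! ## Rung 9f: boxes with algebraic corners -/

/-- **The Kontsevich–Zagier kernel conjecture for separated-variables rational integrands on closed boxes with algebraic corners
(rung 9f; lead c5).** A representation on `Π [lᵢ, uᵢ]` (`lᵢ < uᵢ` real algebraic) with integrand `Σⱼ γⱼ Pⱼ(x_{aⱼ})/Qⱼ(x_{aⱼ})`
(`Pⱼ, Qⱼ ∈ K[X]`, `K = algebraicClosure ℚ ℝ`, `γⱼ ∈ K`, `Qⱼ` zero-free on `[l_{aⱼ}, u_{aⱼ}]`) and value `0` is a Kontsevich–Zagier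
relation: ONE affine change of variables (`stub_boxToCube`, rule (2), constant Jacobian) moves it to the closed unit cube, where the
integrand is again separated `K`-rational (the polynomials composed with the affine map) and THEOREM D applies
(`of_mem_relations_separatedRat`). [cite: KontsevichZagier2001, §1.2 Conjecture 1] -/
theorem of_mem_relations_separatedRat_box {N : ℕ} {ι : Type*} [Fintype ι] (l u : Fin N → algebraicClosure ℚ ℝ)
    (hlu : ∀ i, (l i : ℝ) < u i) (γ : ι → algebraicClosure ℚ ℝ) (P Q : ι → Polynomial (algebraicClosure ℚ ℝ)) (a : ι → Fin N)
    (hQ : ∀ j, ∀ w ∈ Set.Icc (l (a j) : ℝ) (u (a j)), (Polynomial.aeval w (Q j) : ℝ) ≠ 0)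
    (r : IntegralRep N) (hr : r.domain = Set.pi Set.univ (fun i => Set.Icc (l i : ℝ) (u i)))
    (hri : ∀ x ∈ Set.pi Set.univ (fun i => Set.Icc (l i : ℝ) (u i)), r.integrand x =
      ∑ j, (γ j : ℝ) * ((Polynomial.aeval (x (a j)) (P j) : ℝ) / Polynomial.aeval (x (a j)) (Q j)))
    (hv : r.value = 0) : of r ∈ relations := by
  classical
  obtain ⟨t, ht, hti, hrel⟩ := stub_boxToCube N (fun i => (l i : ℝ)) (fun i => (u i : ℝ)) r
    (fun i => Summit.KontsevichZagierPeriods.HurwitzMicroSectors.NormalFormPrinciple.PiBox.AlgSplitK5.isAlgebraic_coeK _)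
    (fun i => Summit.KontsevichZagierPeriods.HurwitzMicroSectors.NormalFormPrinciple.PiBox.AlgSplitK5.isAlgebraic_coeK _) hlu hr
  -- the cubified integrand is separated `K`-rational
  set S : ι → Polynomial (algebraicClosure ℚ ℝ) := fun j =>
    Polynomial.C (l (a j)) + Polynomial.C (u (a j) - l (a j)) * Polynomial.X with hS
  set c : algebraicClosure ℚ ℝ := ∏ i, (u i - l i) with hc
  have hSeval : ∀ j (w : ℝ), (Polynomial.aeval w (S j) : ℝ) = (l (a j) : ℝ) + ((u (a j) : ℝ) - l (a j)) * w := by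
    intro j w
    simp only [hS, map_add, map_mul, Polynomial.aeval_C, Polynomial.aeval_X]
    rfl
  have hmapsB : ∀ i, ∀ w ∈ Set.Icc (0:ℝ) 1, (l i : ℝ) + ((u i : ℝ) - l i) * w ∈ Set.Icc (l i : ℝ) (u i) := by
    intro i w hw
    have hd : 0 < (u i : ℝ) - l i := sub_pos.mpr (hlu i)
    constructor <;> nlinarith [hw.1, hw.2]
  have hQ' : ∀ j, ∀ w ∈ Set.Icc (0:ℝ) 1, (Polynomial.aeval w ((Q j).comp (S j)) : ℝ) ≠ 0 := by
    intro j w hw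
    rw [Polynomial.aeval_comp, hSeval]
    exact hQ j _ (hmapsB (a j) w hw)
  have hti' : ∀ x ∈ Set.pi Set.univ (fun _ : Fin N => Set.Icc (0:ℝ) 1), t.integrand x =
      ∑ j, ((c * γ j : algebraicClosure ℚ ℝ) : ℝ) *
        ((Polynomial.aeval (x (a j)) ((P j).comp (S j)) : ℝ) / Polynomial.aeval (x (a j)) ((Q j).comp (S j))) := by
    intro x hx
    have hxB : (fun i => (l i : ℝ) + ((u i : ℝ) - l i) * x i) ∈ Set.pi Set.univ (fun i => Set.Icc (l i : ℝ) (u i)) :=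
      fun i _ => hmapsB i (x i) (hx i (Set.mem_univ _))
    rw [hti x hx, hri _ hxB, Finset.mul_sum]
    refine Finset.sum_congr rfl fun j _ => ?_
    rw [Polynomial.aeval_comp, Polynomial.aeval_comp, hSeval]
    have hcR : ((c * γ j : algebraicClosure ℚ ℝ) : ℝ) = (∏ i, ((u i : ℝ) - l i)) * (γ j : ℝ) := by
      simp only [hc]; push_cast; rfl
    rw [hcR]
    ring
  -- the value is unchanged, so THEOREM D applies on the cube
  have htv : t.value = 0 := by
    have h : eval (of r - of t) = 0 := relations_le_ker_eval_holds hrel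
    rw [map_sub, eval_of, eval_of, hv, zero_sub, neg_eq_zero] at h
    exact h
  have hmem := of_mem_relations_separatedRat (fun j => c * γ j) (fun j => (P j).comp (S j)) (fun j => (Q j).comp (S j)) a
    hQ' t ht hti' htv
  have : of r = (of r - of t) + of t := by abel
  rw [this]
  exact relations.add_mem hrel hmem

end Summit.KontsevichZagierPeriods.KontsevichZagierPeriods.Cruxes.StokesGeneration.FibrewiseStokes

end
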